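import Summits.Ventures.AbcSig.Recipes.EisPackage
import Summits.Ventures.AbcSig.Sieve.CertificateModN

/-!
# Venture AbcSig — the `q = 2` rule at ODD level as a NAMED HYPOTHESIS, and its kernel-checked discharge

HONEST FRAMING. Interface + glue file of a COMPUTATION cell (`pub-abcsig`). No Diophantine statement is proved here and
nothing is a claim on ABC or any summit. `NewformModel.BS04Package` / `NewformModel.EisPackage` type the trace
congruences of [BS04, (3.1) + Lemma 4.2] at the ODD primes `ℓ ∤ nN` only, because [BS04, Lemma 4.2] is printed for odd
`p`. The census engines of the cell also sieve with the prime `q = 2` when the level `N` is ODD (the cell's "Q2-RULE",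
allowed traces `{±1, ±3}`; rows of record: sieve files with `allowed set 'coarse+q2{±1,±3}@odd-level'`, re-derived by the
referee's `refsievecheck`), and the Lean rows so far carried every residual pair closed that way as an opaque CITED
per-orbit hypothesis `hX_…` (citation-backing audit, `plean/g5/THETAVERIFY-RECORD.md` Part C, class Q2-RULE). This file
replaces those opaque hypotheses by ONE named, CITED hypothesis and a kernel certificate:

* `q2Allowed` — the allowed traces with the prime `2` added: `{1, −1, 3, −3}` at `ℓ = 2`, `bs04Allowed ℓ` otherwise.
* `NewformModel.Q2Package` — **CITED NAMED HYPOTHESIS.** For a standing datum `S` (exponent `n`, [BS04, Lemma 3.3]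
  hypotheses, any Frey case) and a newform `f` of ODD level `N` from which `ρ^E_n` arises, the reduction `ψ` modulo the
  prime `ν ∣ n` of [BS04, p. 31] satisfies `ψ(c_ℓ(f)) ∈ q2Allowed ℓ` for EVERY prime `ℓ ≠ n`, `ℓ ∤ N` — i.e. the
  congruences of `BS04Package` (2) and, in addition, `c₂(f) ≡ ±1` or `±3 (mod ν)`. Printed inputs (for the intended
  model): [BS04, (3.1), p. 31] "`trace ρ_{f,ν}(Frob_p) ≡ c_p (mod ν)` for all `p` not dividing `Mn`" (at odd level `M`
  this includes `p = 2`); [Kraus 1997, §3, (5)–(6), pp. 1143–1144]: for the newform attached to `ρ_p(E)` of level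
  `N(ρ_p)`, `a_l ≡ a_l(E) (mod 𝔓)` if `l ∤ p·N_E` and `a_l ≡ ±(l + 1) (mod 𝔓)` if `l ∣ N_E`, `l ∤ p·N(ρ_p)`; [BS04,
  Lemma 2.1]: the curve `E₃` of case (v) has good reduction at `2` when `ord₂(B bⁿ) = 6` and multiplicative reduction at
  `2` when `ord₂(B bⁿ) ≥ 7`, while in cases (i)–(iv) the `2`-part of the conductor `N_n^E` of `ρ^E_n` is at least `2²`
  [BS04, Lemma 3.2], so `ρ^E_n` is ramified at `2` and cannot arise from a newform of odd level (`ρ_{f,ν}` is unramified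
  outside `nN`) — the hypothesis is vacuous there. The trace of `Frob₂` in the good case: `E₃ : Y² + XY = X³ +
  ((cC − 1)/4) X² + (BC bⁿ/64) X` [BS04, p. 27] has odd discriminant there (`ord₂ Δ = 2·6 − 12 = 0`, [BS04, Lemma 2.1(a)]),
  and its rational point `(0, 0)` of order `2` reduces to a point of order `2` of `Ẽ(𝔽₂)` (`−(0,0) = (0, −0 − 0) = (0,0) ≠ O`),
  so `#Ẽ(𝔽₂) = 3 − a₂` is even, `a₂(E₃)` is odd and `|a₂| ≤ 2√2` gives `a₂(E₃) = ±1`; in the multiplicative, level-lowered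
  case (`2 ∣ N_E`, `2 ∤ N(ρ̄)`, the sub-class `ord₂(B bⁿ) ≡ 6 (mod n)` of the referee record `referee/E3-LEVEL-LEMMA.md`)
  Kraus's (6) gives `±3`. Hence `allowed(2) = {±1, ±3}` — exactly the cell's Q2-RULE. CITED, never proved here; rows take
  `(hQ : M.Q2Package)`. It implies clause (2) of `BS04Package` at odd level and is of the same epistemic kind.
* Glue (PROVED here): `NewformModel.excludesStd_of_q2_eliminated` — `Q2Package` + `N` odd + a kernel certificate
  `X.Eliminated q2Allowed n` (`Sieve/Certificate.lean` / `Sieve/CertificateModN.lean` are parametric in the allowed-trace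
  function) ⇒ `M.ExcludesStd N X n`; `NewformModel.excludesStd_of_q2_rematch` — the same for orbit data `o` from a
  certificate on a second datum `X` (the orbit's eigenvalues INCLUDING `c₂`, possibly re-based) under the COMPUTED
  hypothesis `∀ f, M.Matches f o → M.Matches f X` (two presentations of one eigenvalue system, transcription-audited
  outside Lean exactly like `DataComplete`; cf. `Recipes/SieveDischarge.lean`).

References: [BS04] Bennett–Skinner, Canad. J. Math. 56 (2004), (3.1), Lemma 2.1, Lemma 3.2, Lemma 3.3, p. 27; A. Kraus,
"Majorations effectives pour l'équation de Fermat généralisée", Canad. J. Math. 49 (1997) 1139–1161, §3 (5)–(6) (typed AS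
PRINTED in `run/shared/lean/pub/pub-abcsig/lit/Kraus1997-asprinted.md`); cell records `referee/E3-LEVEL-LEMMA.md`
(§Consequences: "the q = 2 trace of the newform is ≡ a₂(E)·3 ≡ ±3 … the cell's Q2-RULE, which already allows {±1, ±3} at
odd levels"), `Recipes/BS04.lean`, `Recipes/EisPackage.lean` (`Standing`, `ExcludesStd`).
-/

namespace Summit.Ventures.AbcSig

open Polynomial

/-- Allowed traces of Frobenius of `ρ^E_n` at a prime `ℓ ∤ nN`, `N` ODD, with the prime `ℓ = 2` included:
`{1, −1, 3, −3}` at `2` (the cell's Q2-RULE, see the module docstring) and `bs04Allowed ℓ` [BS04, Lemma 4.2] at odd `ℓ`. -/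
def q2Allowed (ℓ : ℕ) : List ℤ :=
  if ℓ = 2 then [1, -1, 3, -3] else bs04Allowed ℓ

/-- `q2Allowed` at the prime `2`. -/
theorem q2Allowed_two : q2Allowed 2 = [1, -1, 3, -3] := rfl

/-- `q2Allowed` agrees with `bs04Allowed` at every `ℓ ≠ 2`. -/
theorem q2Allowed_of_ne_two {ℓ : ℕ} (h : ℓ ≠ 2) : q2Allowed ℓ = bs04Allowed ℓ := if_neg h

/-- **NAMED HYPOTHESIS (CITED) — the Q2-RULE: [BS04, (3.1)] + [Kraus 1997, §3 (5)–(6)] + [BS04, Lemma 2.1 / 3.2].**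
For a standing datum `S` (exponent `n`) and a newform `f` of ODD level `N` from which `ρ^E_n` arises there is a ring
homomorphism `ψ : Coeff f → k` to a field of characteristic `n` (reduction modulo the prime `ν ∣ n`) with
`ψ(c_ℓ(f)) ∈ q2Allowed ℓ` for every prime `ℓ ≠ n` with `ℓ ∤ N` — the odd primes as in `BS04Package` (2), and
`c₂(f) ≡ ±1, ±3 (mod ν)`. See the module docstring for the printed inputs and the one-paragraph argument at `ℓ = 2`.
CITED, never proved here. -/
def NewformModel.Q2Package (M : NewformModel) : Prop :=
  ∀ (S : FreyDatum) (κ : FreyCase), Standing S κ →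
    ∀ (N : ℕ) (f : M.Form N), ¬ 2 ∣ N → M.Arises S N f →
      ∃ (k : Type) (_ : Field k) (_ : CharP k S.n) (ψ : M.Coeff N f →+* k),
        ∀ ℓ : ℕ, ℓ.Prime → ℓ ≠ S.n → ¬ ℓ ∣ N → ∃ t ∈ q2Allowed ℓ, ψ (M.eig N f ℓ) = (t : k)

/-- `Q2Package` implies the trace-congruence clause of `BS04Package` at odd level (sanity link between the two named
hypotheses; not used by the rows). -/
theorem NewformModel.Q2Package.arisesMod (M : NewformModel) (hQ : M.Q2Package) {S : FreyDatum} {κ : FreyCase}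
    (hS : Standing S κ) {N : ℕ} (hN : ¬ 2 ∣ N) (f : M.Form N) (hf : M.Arises S N f) :
    M.ArisesMod f S.n bs04Allowed := by
  obtain ⟨k, hk, hc, ψ, hψ⟩ := hQ S κ hS N f hN hf
  refine ⟨k, hk, hc, ψ, fun ℓ hℓ h2 hn hNℓ => ?_⟩
  obtain ⟨t, ht, hψt⟩ := hψ ℓ hℓ hn hNℓ
  exact ⟨t, by rwa [q2Allowed_of_ne_two h2] at ht, hψt⟩

/-- **Kernel certificate with the prime 2 ⇒ standing-datum exclusion (odd level).** If the data `X` are sieve-eliminated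
at the exponent `n` against `q2Allowed` and every listed entry is at a prime not dividing the odd level `N`, then no
standing datum of exponent `n` has `ρ^E_n` arising from a newform matching `X` (modulo the CITED `Q2Package`). -/
theorem NewformModel.excludesStd_of_q2_eliminated (M : NewformModel) (hQ : M.Q2Package) {N : ℕ} (hN : ¬ 2 ∣ N)
    (X : OrbitData) (n : ℕ) (helim : X.Eliminated q2Allowed n) (hgood : ∀ e ∈ X.coeffs, e.ell.Prime ∧ ¬ e.ell ∣ N) :
    M.ExcludesStd N X n := by
  intro S κ hS hn f hfo harises
  obtain ⟨θ, hF, hco⟩ := hfo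
  obtain ⟨k, hk, hchar, ψ, hψ⟩ := hQ S κ hS N f hN harises
  have hchar' : CharP k n := hn ▸ hchar
  let φ : ℤ[X] →+* k := ψ.comp (Polynomial.eval₂RingHom (Int.castRingHom (M.Coeff N f)) θ)
  have hφ : ∀ P : List ℤ, φ (toPoly P) = ψ (evalL θ P) := fun P => rfl
  refine helim k φ ⟨?_, ?_⟩
  · rw [hφ, hF, map_zero]
  · intro e he hne
    obtain ⟨hp, hNe⟩ := hgood e he
    obtain ⟨t, ht, hψt⟩ := hψ e.ell hp (by rw [hn]; exact hne) hNe
    refine ⟨t, ht, ?_⟩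
    rw [hφ, ← hco e he, map_mul, hψt, map_intCast]

/-- **Re-based / extended presentation.** If every newform matching `o` also matches the data `X` (COMPUTED hypothesis:
`X` = the same Hecke eigenvalue system with the eigenvalue `c₂` listed, possibly in another generator) and `X` is
sieve-eliminated at `n` against `q2Allowed` in the kernel, then `M.ExcludesStd N o n` at the odd level `N`. -/
theorem NewformModel.excludesStd_of_q2_rematch (M : NewformModel) (hQ : M.Q2Package) {N : ℕ} (hN : ¬ 2 ∣ N)
    (o X : OrbitData) (hM : ∀ f : M.Form N, M.Matches f o → M.Matches f X) (n : ℕ)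
    (helim : X.Eliminated q2Allowed n) (hgood : ∀ e ∈ X.coeffs, e.ell.Prime ∧ ¬ e.ell ∣ N) :
    M.ExcludesStd N o n := by
  intro S κ hS hn f hfo harises
  exact M.excludesStd_of_q2_eliminated hQ hN X n helim hgood S κ hS hn f (hM f hfo) harises

end Summit.Ventures.AbcSig
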